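import Literature.IUT.HodgeArakelov.ThetaEvaluationSettingModelAssembly2
import Literature.AnabelianGeometry.EtaleTheta.Discharge.Sec1DeckSign
import Literature.AnabelianGeometry.EtaleTheta.Discharge.Sec2YdduuTranslates

/-!
# [IUTchII] Prop 2.2 (ii)′ at the MODEL: the (R2) sign and (R3) non-torsion binders from the [EtTh] §1 NAMED FACTS
# Prop 1.5 (ii), (iii) (junction of abc-iut-w4-d010's class-level assembly with the §1-level dischargers)

S. Mochizuki, *Inter-universal Teichmüller theory II*, kurims manuscript (Dec. 2020) §2, Prop. 2.2 (ii) p. 66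
(claim key `Mochizuki2012`, DISPUTED, D-0012) [cite: Mochizuki2012, Prop 2.2 (ii) p.66]; [EtTh] Prop. 1.5 (ii), (iii)
PRIMS PDF p. 23, Def. 2.7 p. 41 [cite: MochizukiEtTh2009, Prop 1.5 (iii) p.23]. PROOF-ONLY companion (no
definitions, no new named fact; cell abc-iut, seat abc-iut-L2-t8 — the `X̲̲`-layer / §2-transport owner; node
**IUTchII:Prop2.2(ii)**, GAP row G-w4d010-2 (R2)/(R3)). Nothing here takes a side on [IUTchIII] Cor. 3.12.

abc-iut-w4-d010's `prop22_ii'_model_of_inversion_of_classLevel` (`ThetaEvaluationSettingModelAssembly2.lean`,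
p417690) closes [IUTchII] Prop. 2.2 (ii)′ at `D := etaleThetaDataOfSetting'` from the (R1) inversion datum and THREE
`Δ_Θ`-CLASS-level statements about the étale theta class `η̈^Θ`: `h14sign`, `h14iota`, `h14free`. Two of them are
now theorems from the §1 NAMED FACTS:

* `h14sign` ("`Θ̈(−Ü) = −Θ̈(Ü)`" at the class level: the deck transformation `ε ∈ Π^tp_Y ∖ Π^tp_Ÿ` moves `η̈^Θ` by a
  class of square `1`) ⟸ [EtTh] Prop. 1.5 (iii) = the named fact `Prop15iii` under `K = K̈`: abc-iut-L2-t1's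
  `EtaleThetaData.exists_sq_eq_one_and_conj_eq` (`Discharge/Sec1DeckSign.lean`, p416122);
* `h14free` (the pulled-back translates `(γᵏ·η̈^Θ)·(η̈^Θ)⁻¹`, `k ≠ 0`, are not torsion) ⟸ [EtTh] Prop. 1.5 (iii), (ii)
  = `Prop15iii`, `Prop15ii`, the printed clause "`F̈¹/F̈² = Ẑ · log(Ü)`" (`hL`, plan/GAP-LEDGER G-L2t1-1) and the
  freeness guard `IsEtThOrigin`: abc-iut-L2-t1's `not_isOfFinOrder_comap_conj_zpow_div` (p415695) with the power
  condition supplied by abc-iut-L2-t8's `DoubleUnderline.not_isOfFinOrder_comap_conj_zpow_etaDd_div`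
  (`Discharge/Sec2YdduuTranslates.lean`, p417058).

NET: `prop22_ii'_model_of_inversion_of_prop15` — Prop. 2.2 (ii)′ at the model from EXACTLY: the model data, (H1)
`PiYddCharacteristic`, the (R1) inversion datum (`ι`, `hι`, theta companion `c`, `hZ`, `δ`/`hιι`, `hβ`, `γ`, `ε`),
the ONE remaining class-level statement `h14iota` ("`Θ̈(Ü) = −Θ̈(Ü⁻¹)`": `ι` carries `η̈^Θ` to its `ε`-conjugate —
still function-level, abc-iut-w5-d125's `autMap_comap_etaDd_eq_conj`, or a future §1 fact for the untyped inversion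
clause of Prop. 1.5 (iii)), and the named §1 facts `Prop15iii`, `Prop15ii` + `hL` + `IsEtThOrigin`.
[claim: Mochizuki2012, status: disputed] typed ≠ proved.
-/

namespace Literature.IUT.HodgeArakelov

open Literature.AnabelianGeometry.EtaleTheta (ContH1 ThetaSetting)
open Literature.AnabelianGeometry.EtaleTheta
open EtaleThetaDataOfSetting CohomologySystemOfContH1

noncomputable section

namespace EtaleThetaDataOfSetting

variable {p : ℕ} [Fact p.Prime] {D : Literature.AnabelianGeometry.EtaleTheta.ThetaSetting p}
  {E : D.EtaleThetaData} {l : ℕ} (C : E.DoubleUnderline l)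
  (ι : D.PiTemp ≃ₜ* D.PiTemp) (hι : C.Huu.map ι.toMulEquiv.toMonoidHom = C.Huu)
  (c : ThetaSetting.ThetaCompanion ι)

/-- `Π^tp_Ÿ̲̲ ⊆` the image of `Π_Ÿ(Π) ∩ ⊤ ⊆ Π^tp_X̲̲` in `Π^tp_X` (in fact equal: `Π_Ÿ(Π) := Π^tp_Ÿ̲̲`).
[cite: MochizukiEtTh2009, Def 2.7 p.41] -/
theorem GtpYdduu_le_map_subtype_piYdd_inf_top : C.GtpYdduu ≤ (PiYdd C ⊓ ⊤).map C.Huu.subtype :=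
  fun x hx => ⟨⟨x, (Subgroup.mem_inf.mp hx).2⟩,
    Subgroup.mem_inf.mpr ⟨Subgroup.mem_subgroupOf.mpr hx, Subgroup.mem_top _⟩, rfl⟩

/-- **Binder `h14sign` of `prop22_ii'_model_of_inversion_of_classLevel` from the named fact `Prop15iii`**
("`Θ̈(−Ü) = −Θ̈(Ü)`" at the `Δ_Θ`-class level: abc-iut-L2-t1's `exists_sq_eq_one_and_conj_eq` at `x := η̈^Θ`).
[cite: MochizukiEtTh2009, Prop 1.5 (iii) p.23] -/
theorem h14sign_of_prop15iii [D.GtpYdd.Normal] (hC : D.Compat) (hS : D.Sec2Hyps)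
    (h15 : ThetaSetting.Prop15iii E hC) (ε : Pi C) (hε₁ : (ε : D.PiTemp) ∈ D.GtpY) :
    ∃ κ₁ : ContH1 D.toTheta D.DeltaTheta D.GtpYdd, κ₁ ^ 2 = 1 ∧
      ContH1.conj D.toTheta D.DeltaTheta (ε : D.PiTemp) E.etaDd = E.etaDd * κ₁ :=
  E.exists_sq_eq_one_and_conj_eq hC hS h15 hε₁ E.etaDd_mem_thetaClasses

/-- **Binder `h14free` of `prop22_ii'_model_of_inversion_of_classLevel` from the named facts `Prop15iii`, `Prop15ii`,
the printed clause `hL` and `IsEtThOrigin`** (abc-iut-L2-t1's translate lemma with abc-iut-L2-t8's power condition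
at `Π^tp_Ÿ̲̲`). [cite: MochizukiEtTh2009, Prop 1.5 (iii) p.23] -/
theorem h14free_of_prop15 [D.GtpYdd.Normal] (hC : D.Compat) (hO : D.IsEtThOrigin)
    (h15 : ThetaSetting.Prop15iii E hC) (h15ii : ThetaSetting.Prop15ii E.toKummerData hC)
    (hL : ∀ n : ℤ, E.logUdd ^ n ∈
      (ThetaSetting.Fdd2 : Subgroup (D.H1Theta (D.GtpYdd.map D.toTheta))) → n = 0)
    (γ : Pi C) (hγ : C.toLZ γ = Multiplicative.ofAdd 1) :
    ∀ k : ℤ, k ≠ 0 → ¬ IsOfFinOrder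
      (ContH1.comap D.toTheta D.DeltaTheta C.Huu.subtype continuous_subtype_val
        (map_subtype_piYdd_inf_le_GtpYdd C ⊤)
        (ContH1.conj D.toTheta D.DeltaTheta ((γ : D.PiTemp) ^ k) E.etaDd * E.etaDd⁻¹)) :=
  fun _ hk => C.not_isOfFinOrder_comap_conj_zpow_etaDd_div hC hO h15 h15ii hL continuous_subtype_val
    (map_subtype_piYdd_inf_le_GtpYdd C ⊤) (GtpYdduu_le_map_subtype_piYdd_inf_top C) hγ hk

/-- **IUTchII:Prop2.2(ii)′ at the model `Π_v := Π^tp_X̲̲`, (R2)-sign and (R3) from the [EtTh] §1 NAMED FACTS**: the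
repaired `Prop22_ii' Dec` HOLDS at `D := etaleThetaDataOfSetting'` for every Prop. 2.2 (i) datum `Dec`, GIVEN
EXACTLY: the model data (`C`, `hC`, `hS`, (H1) `hchar`, `S`, `eS`, `hl`); the (R1) inversion datum (`ι` with
`ι(Π^tp_X̲̲) = Π^tp_X̲̲`, theta companion `c`, `ℤ`-reversal `hZ` at the `toLZ`-generator `γ`, `ι² = conj δ` on `Π^tp_X̲̲`,
`ι ≡ +1` on `Δ_Θ/l·Δ_Θ`, deck element `ε ∈ Π^tp_Y ∖ Π^tp_Ÿ`); the class-level `ι`-statement `h14iota`; and the named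
§1 facts [EtTh] Prop. 1.5 (iii) (`Prop15iii`), Prop. 1.5 (ii) (`Prop15ii` + the printed clause `hL`,
"`F̈¹/F̈² = Ẑ·log(Ü)`") together with the freeness guard `IsEtThOrigin` — abc-iut-w4-d010's
`prop22_ii'_model_of_inversion_of_classLevel` with `h14sign := h14sign_of_prop15iii`, `h14free := h14free_of_prop15`.
[claim: Mochizuki2012, status: disputed] (IUTchII §2 Prop 2.2 (ii), kurims p.66) -/
theorem prop22_ii'_model_of_inversion_of_prop15 [(PiYdd C).Normal] [D.GtpYdd.Normal]
    (hC : D.Compat) (hS : D.Sec2Hyps) (hchar : PiYddCharacteristic C) (S : BadPlaceSetting.{0})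
    (eS : (Pi C) ≃ₜ* S.PiX) (hl : S.l = l) {T₀ : TemperedCoverings S (Pi C)}
    (Dec : SubgraphDecomposition S T₀ (etaleThetaDataOfSetting' C hC hS hchar S.toThetaSetting eS hl))
    -- (R1) the inversion datum
    (γ ε : Pi C) (hγ : C.toLZ γ = Multiplicative.ofAdd 1) (hε₁ : (ε : D.PiTemp) ∈ D.GtpY)
    (hε₂ : (ε : D.PiTemp) ∉ D.GtpYdd) (hZ : D.toZ (ι (γ : D.PiTemp)) = (D.toZ (γ : D.PiTemp))⁻¹)
    (δ : Pi C) (hιι : ∀ x : Pi C, ι (ι (x : D.PiTemp)) = (δ : D.PiTemp) * (x : D.PiTemp) * (δ : D.PiTemp)⁻¹)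
    (hβ : ∀ a : D.GtpTheta, a ∈ D.DeltaTheta → c.thetaIso a * a⁻¹ ∈ D.lDeltaTheta l)
    -- (R2) the class-level ι-statement ("Θ̈(Ü) = −Θ̈(Ü⁻¹)"), still a binder
    (h14iota : ContH1Aut.autMap (phi C) D.DeltaTheta (inversionAlpha C ι hι) c.thetaIso
        (thetaCompanion_phi C ι hι c) (thetaCompanion_mem_deltaTheta ι c)
        (symm_mem_inf_top (PiYdd C) (inversionAlpha C ι hι) (mem_PiYdd_iff_of_piYddCharacteristic C hchar _))
        (ContH1.comap D.toTheta D.DeltaTheta C.Huu.subtype continuous_subtype_val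
          (map_subtype_piYdd_inf_le_GtpYdd C ⊤) E.etaDd) =
      ContH1.conj (phi C) D.DeltaTheta ε
        (ContH1.comap D.toTheta D.DeltaTheta C.Huu.subtype continuous_subtype_val
          (map_subtype_piYdd_inf_le_GtpYdd C ⊤) E.etaDd))
    -- the [EtTh] §1 named facts
    (hO : D.IsEtThOrigin) (h15 : ThetaSetting.Prop15iii E hC) (h15ii : ThetaSetting.Prop15ii E.toKummerData hC)
    (hL : ∀ n : ℤ, E.logUdd ^ n ∈
      (ThetaSetting.Fdd2 : Subgroup (D.H1Theta (D.GtpYdd.map D.toTheta))) → n = 0) :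
    Prop22_ii' Dec :=
  prop22_ii'_model_of_inversion_of_classLevel C ι hι c hC hS hchar S eS hl Dec γ ε hγ hε₁ hε₂ hZ δ hιι hβ
    (h14sign_of_prop15iii C hC hS h15 ε hε₁) h14iota (h14free_of_prop15 C hC hO h15 h15ii hL γ hγ)

end EtaleThetaDataOfSetting

end

end Literature.IUT.HodgeArakelov
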